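import Literature.Computability.AlgebraicComplexity.PowerSumProductMultiplicityObstruction
import Literature.Computability.AlgebraicComplexity.EquivariantDC
import Literature.NumberTheory.DiophantineGeometry.WeylModuleOneRowForms
import Mathlib.RepresentationTheory.Invariants
import Mathlib.LinearAlgebra.Matrix.Permutation
import HarnessLib

/-!
# Ikenmeyer–Kandasamy 2020, §§3–5 and §§8–13 typed: multiplicities in `ℂ[\overline{GL_m · p}]`
# from the symmetries of the power sum `p`, and the Tableau Lifting Theorem

Typed literature (cell `val-lit`, row IK20-A/B; honest framing: bookkeeping of printed
statements about Ikenmeyer–Kandasamy's toy model `p = x₁^D + ⋯ + x_m^D` versus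
`q = x₁ ⋯ x_D`; VP ≠ VNP is NOT proved and nothing here is progress on it).

Source: C. Ikenmeyer, U. Kandasamy, *Implementing geometric complexity theory: On the
separation of orbit closures via symmetries*, STOC 2020 = arXiv:1911.03990 (one version, v1;
key `IkenmeyerKandasamy2019`). PRINTED NUMBERING: the paper numbers every theorem-like
environment AND every numbered equation with one counter per section (`\numberwithin{equation}
{section}`), so §4 reads Prop. 4.1, Thm. 4.2 (Main Technical Theorem), Thm. 4.3, eq. (4.4),
Cor. 4.5; §5: Lemma 5.1, Lemma 5.2, Prop. 5.3; §8: Lemma 8.1, eq. (8.2), Cor. 8.3–8.5; §9: Thm. 9.1,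
Thm. 9.2, (9.3), (9.4), Prop. 9.5; §10: Prop. 10.1, Claim 10.2; §11: Thm. 11.1; §12: Prop. 12.1,
Claim 12.2; §13: Thm. 13.1 (Tableau Lifting Theorem). The held text `paper:arxiv-1911.03990`
(35 chunks `pNNNN.txt` of the TeX) numbers the same environments SEQUENTIALLY (Proposition 1,
Theorem 2, …, Theorem 20); every docstring gives both, as `[chunk pNNNN.txt:Ln 'Theorem k']`,
plus the TeX line of `pub-gct/inputs/files/src/1911.03990/main.tex`.

## Setting (§3, p0005–p0007; TeX L303–363)

`G = GL_m(ℂ)` acts on `Sym^D ℂ^m` by `(g p)(x) = p(gᵗ x)` — the tree's `linSubst`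
(`X_i ↦ ∑_j g_{ji} X_j`); `p := x₁^D + ⋯ + x_m^D` is Mathlib's `MvPolynomial.psum (Fin m) ℂ D`,
`H := stab p` is the tree's `linStabilizer p` (`EquivariantDC.lean`; `= ℤ_D^m ⋊ 𝔖_m` for
`D ≥ 3`, §3). `{λ}` is the irreducible polynomial `GL_m`-representation of a partition `λ` with
at most `m` parts — the tree's Weyl module `weylRep k (Fin m) λ` (`SchurWeylPlethysm.lean`);
`mult_{λ^*} ℂ[\overline{Gp}]` is `orbitMultiplicity ℂ p D (Weight.dualOfPartition m λ)` and the
plethysm coefficient `a_λ(d, D) = mult_{λ^*} ℂ[Sym^D ℂ^m]_d` (λ ⊢ dD) is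
`plethysmCoeffOfPartition ℂ m D λ` (dual-weight convention; the weight pins `d`), exactly as in
`PowerSumProductObstructions.lean`. Standing assumption of §2 (p0005.txt:L4): "For `m ≥ D` let
`p := x₁^D + ⋯ + x_m^D`"; and of §3: `D ≥ 3` (stabilizer). Both are kept as hypotheses of
every fact below (a fact is never stated for a wider range than the paper works in).

## The dictionary for the coordinate ring of the ORBIT (not in the tree)

Prop. 4.1, Lemma 5.1, Lemma 5.2, Thm. 9.1 and Prop. 9.5 speak about `ℂ[Gp]`, the coordinate
ring of the orbit `Gp ≅ G/H` (an affine variety), which the tree does not render (only orbit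
CLOSURES: `OrbitCoordRing`, `orbitCoordRep`; cf. the docstring of `IK2020_thm_4_3`: "the middle
term `ℂ[Gq]` … is not rendered"). IK themselves reduce it to invariant theory in §9
(p0015.txt:L48–74; TeX L769–798): `ℂ[Gp] ≅ ℂ[G]^{H}` [TY:05, 25.4.6] (9.3), and by the
explicit algebraic Peter–Weyl theorem (Thm. 9.2 = [Lan:17, Thm. 8.6.4.3])
"`HWV_{λ^*}(ℂ[G]^{H}) ≃ {λ}^H`" (the prose line TeX L792 between (9.3) and (9.4); (9.4) itself is
the spanning set `g ↦ γ(gv)`, `v ∈ {λ}^H` — below "via (9.4)" refers to this pair of lines).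
Hence, for `λ ⊢_m dD`,
`mult_{λ^*} ℂ[Gp] = mult_{λ^*} ℂ[Gp]_d = dim {λ}^H`. Every printed occurrence of
`mult_{λ^*} ℂ[Gp]` is TYPED AS `dim {λ}^H = IK2020.weylInvariantDim ℂ m λ (linStabilizer p)`
(a real definition: the dimension of the `H`-invariants of the Weyl module), and each such
docstring says so ("via (9.4)").

## What is typed (decl ↦ printed item)

* §3 vocabulary: `IK2020.freq` (frequency notation `ρ̂`), `IK2020.blockPermHom`,
  `IK2020.multiYoungSymmetrizer`, `IK2020.multiWeylModule`, `IK2020.multiWeylRep`,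
  `IK2020.multiLRCoeff` (multi-Littlewood–Richardson coefficient `c^λ_{μ¹,…,μ^d}` — Weyl's
  construction applied blockwise inside `V^{⊗(n₁+⋯+n_d)}`), `IK2020.addRect` (`λ + (m × c)`),
  `IK2020.permGL` (`𝔖_m ⊆ GL_m`), `IK2020.weylInvariantDim` (`dim {λ}^H`).
* Prop. 4.1 ↦ `IK2020.bCoeff` (the printed `b(λ,ϱ,D,d)`) and FACT `IK2020_prop_4_1` (via (9.4)).
* Thm. 4.2 ↦ `IK2020.ceilDiv`, `IK2020.eRho` (`e_ϱ`, both parities), `IK2020.eXi` (`e_Ξ`), FACT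
  `IK2020_thm_4_2`.
* Thm. 4.3 ↦ CITED, not restated: `IK2020_thm_4_3` / `IK2020_thm_4_3_holds`
  (`PowerSumProductObstructions.lean`, `PowerSumProductMultiplicityObstruction.lean`); its two
  bookkeeping sentences "`e_{(2)} = 1`, `e_{(1,1)} = 2`, thus `e_Ξ = 2`" and "`ν = λ + (m × e_Ξ D)`"
  are PROVED on this file's vocabulary (`IK2020.eRho_eXi_thm_4_3`,
  `IK2020.addRect_indiscrete_parts_eq_ikPartition`: the shifted partition IS the tree's
  `ikPartition m`), tying `IK2020_thm_4_2`'s data to the tree's statement of Thm. 4.3.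
* Cor. 4.5 ↦ FACT `IK2020_cor_4_5` (plethysm positivity).
* Lemma 5.1 [BI:17] ↦ FACT `IK2020_lemma_5_1` (via (9.4)); Lemma 5.2 ↦ `IK2020.eCormain`, FACT
  `IK2020_lemma_5_2` (first equality, via (9.4)).
* Prop. 5.3 ↦ CITED: `IK2020_prop_5_3_1_holds`, `IK2020_prop_5_3_2_holds`,
  `IK2020_prop_5_3_2_primes_holds`.
* §8 (Lemma 8.1 / eq. (8.2), Cor. 8.3–8.5) ↦ `IK2020.colTopDet`, `IK2020.gammaProd` (eq. (8.2)
  taken as the DEFINITION of `γ(gT)`, as the tree's tableau calculus does — `TabM.EC_powers`,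
  `TableauPolynomial.lean`), PROVED `IK2020_cor_8_4`, `IK2020_cor_8_4_sl`, `IK2020_cor_8_5`.
* Thm. 9.2 (explicit algebraic Peter–Weyl) ↦ NOT TYPED (the `G × G`-module `ℂ[G]` is not in
  the tree; cite-only [Lan:17, Thm. 8.6.4.3]). Thm. 9.1 / Prop. 9.5 ↦ NOT TYPED (statements about
  generators `g ↦ γ(g P_m S)` of `HWV_{λ^*}(ℂ[Gp]_d)`, `S` semistandard: they need `ℂ[Gp]` AND the
  tableau presentation `{λ} = ⊗^{|λ|}ℂ^m / K(λ)` with its semistandard basis (§6, [Ful:97 §8]),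
  neither of which the tree has — its Weyl module is Weyl's construction `c_λ · V^{⊗d}`).
* Prop. 10.1 ↦ `IK2020.contentSubspace` (`{λ}_ϱ`), `IK2020.permFixed`, FACT `IK2020_prop_10_1`;
  Claim 10.2 ↦ FACT `IK2020_claim_10_2`.
* Thm. 11.1 ↦ first assertion PROVED `IK2020_thm_11_1_1` (for every `λ`, from the tree's
  `nonpos_and_exists_size_eq_of_hasHighestWeight_orbitCoordRep`); last assertion CITED =
  `TableauEval.TabM.tabPoly_mem_highestWeightSpace` (`TableauHighestWeight.lean`) with the
  evaluation formula `TableauEval.TabM.EC_powers` (`PowerSumWaringRankEquation.lean`); middle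
  assertion (generation by the tableau functions `γ(g M_{δ,m} T)`, `T` semistandard of content
  `δ × D`) NOT TYPED (same missing tableau basis; it is [AIR:16] = [BIP:19, Prop. 4.5, Thm. 4.7]).
* Prop. 12.1 ↦ PROVED `IK2020_prop_12_1` (`a_ν(2(m+1), m) > 2` from the tree theorems
  `IK2020_thm_4_3_holds` and `IK2020_prop_5_3_1_holds`); Claim 12.2 ↦ CITED =
  `IK2020.ikPoly_ne_zero` (`PowerSumWaringRankEquation.lean`, with the §12 PRINT ERRATUM on
  `T_right` recorded there and in pub-gct-max AS-PRINTED-1 §26: the printed tableau has shape `ν`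
  only at `m = 4`; the corrected `T_right = (m × (m−2)) + (2m)` is used by the tree).
* Thm. 13.1 (Tableau Lifting Theorem) ↦ `IK2020.ColTableau` vocabulary (`IsRegular`, `count`,
  `relabel`, `IsDuplex`) and FACT `IK2020_thm_13_1`. The hypergraph constructions of §§14–21
  (Def. 14.1, Prop. 14.2, Def. 18.1, Prop. 18.3 and the ≈ 40 Claims) are proof-internal and not
  typed. Delta to BIP §5 (`PlethysmLifting.lean`, the inner degree lifting `κ` of highest-weight
  VECTORS, and BIP's/Kadish–Landsberg's tableau lifting): IK lift a regular TABLEAU `S` of content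
  `Dϱ` to a tableau `T` of shape `λ + (m × e_ϱ D)` all of whose regular `m`-colourings restrict to
  `𝔖_m S` on the right part and are duplex on the left part (§13: "Much simpler forms of other
  tableau lifting theorems appeared in [KL:12, BIP:19]").

FACT-LIST marks: `-- FACT` = named `def … : Prop` with cite tag, not proved here (R1: Schur–Weyl /
Peter–Weyl / Specht-module machinery or the 60-page lifting construction); `-- DISCHARGEABLE`
= proved here or a finite linear-algebra statement; nothing in this file is an open problem.

## References

* C. Ikenmeyer, U. Kandasamy, STOC 2020, 713–726 = arXiv:1911.03990. [IkenmeyerKandasamy2019]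
* P. Bürgisser, C. Ikenmeyer, *Fundamental invariants of orbit closures*, J. Algebra 477 (2017)
  (Lemma 5.1 is quoted from there by IK). [BurgisserIkenmeyer2017]
* J.M. Landsberg, *Geometry and complexity theory*, CUP 2017, Thm. 8.6.4.3, §9.2.3. [Landsberg2017]
* P. Tauvel, R. Yu, *Lie algebras and algebraic groups*, Springer 2005, 25.4.6. [TauvelYu2005]
-/

noncomputable section

open MvPolynomial
open scoped BigOperators

namespace Literature.Computability.AlgebraicComplexity

open _root_.Literature.NumberTheory.DiophantineGeometry

namespace IK2020

/-! ## §3 vocabulary: frequency notation, multi-Littlewood–Richardson coefficients -/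

/-- The **frequency notation** `ρ̂` of a partition `ϱ ⊢ d`: `ρ̂_i = |{j | ϱ_j = i}|`
(IK §3, TeX L360–361; chunk p0007.txt:L7: "the frequency notation `ρ̂ ∈ ℕ^m` is defined via
`ρ̂_i := |{j | ϱ_j = i}|`", e.g. `ϱ = (3,3,2,0) ↦ ρ̂ = (0,1,2,0)`).
[cite: IkenmeyerKandasamy2019, §3] -/
def freq {d : ℕ} (ρ : Nat.Partition d) (i : ℕ) : ℕ :=
  ρ.parts.count i

/-- The block embedding `𝔖_{n_i} ↪ 𝔖_{n₁ + ⋯ + n_d}`: a permutation of the `i`-th block acts on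
the positions `n₁ + ⋯ + n_{i-1} + (0 … n_i - 1)` of `Fin (∑ n_j)` (through Mathlib's
`finSigmaFinEquiv`) and fixes the other blocks (the Young-subgroup embedding used for
`{μ¹} ⊗ ⋯ ⊗ {μ^d}`, IK §3, TeX L353–357). [folklore] -/
def blockPermHom {d : ℕ} (n : Fin d → ℕ) (i : Fin d) :
    Equiv.Perm (Fin (n i)) →* Equiv.Perm (Fin (∑ j, n j)) :=
  ((Equiv.permCongrHom (finSigmaFinEquiv (n := n))).toMonoidHom.comp
      (Equiv.Perm.sigmaCongrRightHom fun j => Fin (n j))).comp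
    (MonoidHom.mulSingle (fun j => Equiv.Perm (Fin (n j))) i)

/-- The product `c_{μ¹} c_{μ²} ⋯ c_{μ^d} ∈ k[𝔖_{n₁+⋯+n_d}]` of the Young symmetrizers of the
partitions `μ^i ⊢ n_i` (the tree's `youngSymmetrizer`, Fulton–Harris (4.3)), each moved to its
own block of positions by `blockPermHom` (the blocks commute; the list order is immaterial).
[folklore] -/
def multiYoungSymmetrizer (k : Type*) [Field k] {d : ℕ} {n : Fin d → ℕ}
    (μ : (i : Fin d) → Nat.Partition (n i)) :
    MonoidAlgebra k (Equiv.Perm (Fin (∑ j, n j))) :=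
  (List.ofFn fun i : Fin d =>
    MonoidAlgebra.mapDomainAlgHom k k (blockPermHom n i) (youngSymmetrizer k (μ i))).prod

/-- **`{μ¹} ⊗ ⋯ ⊗ {μ^d}` inside `V^{⊗(n₁+⋯+n_d)}`** (`V = k^N`): the image of
`c_{μ¹} ⊗ ⋯ ⊗ c_{μ^d}` (`multiYoungSymmetrizer`) acting through the tree's `permTensorRep` —
Weyl's construction (`weylModule`, Fulton–Harris §6.1) applied blockwise, so that this
submodule is `S_{μ¹}(V) ⊗ ⋯ ⊗ S_{μ^d}(V)` with the diagonal `GL_N`-action (IK §3, TeX L353–357: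
"tensor products of polynomially many irreducible `G`-representations `{μ¹} ⊗ ⋯ ⊗ {μ^d}` and
embed `G ↪ G × ⋯ × G`"). [cite: IkenmeyerKandasamy2019, §3] -/
def multiWeylModule (k : Type*) [Field k] (N : ℕ) {d : ℕ} {n : Fin d → ℕ}
    (μ : (i : Fin d) → Nat.Partition (n i)) :
    Submodule k (TensorPower k (∑ j, n j) (Fin N → k)) :=
  LinearMap.range
    ((permTensorRep k (Fin N → k) (∑ j, n j)).asAlgebraHom (multiYoungSymmetrizer k μ))

/-- `multiWeylModule` is stable under the diagonal action of `GL_N`, because the `k[𝔖_n]`- and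
`GL_N`-actions on `V^{⊗n}` commute (Fulton–Harris, Lemma 6.22; tree:
`asAlgebraHom_permTensorRep_comp_glTensorRep`). [cite: FultonHarrisGTM129, Lemma 6.22] -/
theorem glTensorRep_mem_multiWeylModule (k : Type*) [Field k] (N : ℕ) {d : ℕ} {n : Fin d → ℕ}
    (μ : (i : Fin d) → Nat.Partition (n i)) (g : GL (Fin N) k)
    {x : TensorPower k (∑ j, n j) (Fin N → k)} (hx : x ∈ multiWeylModule k N μ) :
    glTensorRep (Fin N) k (∑ j, n j) g x ∈ multiWeylModule k N μ := by
  obtain ⟨y, rfl⟩ := hx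
  refine ⟨glTensorRep (Fin N) k (∑ j, n j) g y, ?_⟩
  change ((permTensorRep k (Fin N → k) (∑ j, n j)).asAlgebraHom _ ∘ₗ
    glTensorRep (Fin N) k (∑ j, n j) g) y = _
  rw [asAlgebraHom_permTensorRep_comp_glTensorRep]
  rfl

/-- The diagonal representation of `GL_N` on `{μ¹} ⊗ ⋯ ⊗ {μ^d}` (`multiWeylModule`), the
restriction of the tree's `glTensorRep`. [cite: IkenmeyerKandasamy2019, §3] -/
def multiWeylRep (k : Type*) [Field k] (N : ℕ) {d : ℕ} {n : Fin d → ℕ}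
    (μ : (i : Fin d) → Nat.Partition (n i)) :
    Representation k (GL (Fin N) k) (multiWeylModule k N μ) :=
  (glTensorRep (Fin N) k (∑ j, n j)).subrepresentation (multiWeylModule k N μ) fun g _ hx =>
    glTensorRep_mem_multiWeylModule k N μ g hx

/-- The **multi-Littlewood–Richardson coefficient** `c^λ_{μ¹,…,μ^d}` for `GL_N`: the
multiplicity of `{λ}` in `{μ¹} ⊗ ⋯ ⊗ {μ^d}` (IK §3, TeX L353–357; chunk p0007.txt:L4: "The
corresponding coefficient is called the multi-Littlewood-Richardson coefficient
`c^λ_{μ¹,μ²,…,μ^d}`"), rendered as the dimension of the highest-weight space of weight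
`λ = Weight.ofPartition N λ` (tree: `hwMultiplicity`) in `multiWeylRep`. For `d = 1` this is
`δ_{λ,μ¹}`, for `d = 2` the Littlewood–Richardson coefficient. Junk: `λ` with more than `N`
parts is truncated by `Weight.ofPartition` (users keep `λ.parts.card ≤ N`); for `μ^i` with more
than `N` parts the block Weyl module is `0` and the coefficient is `0`, as it should.
[cite: IkenmeyerKandasamy2019, §3] -/
def multiLRCoeff (k : Type*) [Field k] (N : ℕ) {d : ℕ} {n : Fin d → ℕ}
    (μ : (i : Fin d) → Nat.Partition (n i)) {s : ℕ} (lam : Nat.Partition s) : ℕ :=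
  hwMultiplicity (V := multiWeylModule k N μ) (multiWeylRep k N μ) (Weight.ofPartition N lam)

/-! ## Prop. 4.1: the formula for `mult_{λ^*} ℂ[Gp]` -/

/-- **IK's `b(λ, ϱ, D, d)`** (Prop. 4.1, TeX L372–382; chunk p0008.txt:L6–17 'Proposition 1'):
"`b(λ,ϱ,D,d) := ∑_{μ¹,…,μ^d, μ^i ⊢ D i ρ̂_i} c^λ_{μ¹,…,μ^d} ∏_{i=1}^d a_{μ^i}(ρ̂_i, iD)`" —
the sum over all `d`-tuples of partitions `μ^i ⊢ D·i·ρ̂_i` (`i = 1, …, d`, indexed by `Fin d`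
as `i ↦ i+1`) of the multi-Littlewood–Richardson coefficient times the plethysm coefficients
`a_{μ^i}(ρ̂_i, iD) = mult_{μ^{i*}} k[Sym^{iD} k^m]_{ρ̂_i}` (tree `plethysmCoeffOfPartition k m (iD) μ^i`;
the outer degree `ρ̂_i` is pinned by `|μ^i| = (iD) ρ̂_i`). All coefficients are taken for
`G = GL_m` as in the paper (`{λ}` is a `GL_m`-representation, `a_ν(d,D)` is defined in
`ℂ[Sym^D ℂ^m]`, §3). [cite: IkenmeyerKandasamy2019, Prop. 4.1] -/
def bCoeff (k : Type*) [Field k] (m D d : ℕ) {n : ℕ} (lam : Nat.Partition n)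
    (ρ : Nat.Partition d) : ℕ :=
  ∑ μ : (i : Fin d) → Nat.Partition (D * (i.1 + 1) * freq ρ (i.1 + 1)),
    multiLRCoeff k m μ lam * ∏ i : Fin d, plethysmCoeffOfPartition k m ((i.1 + 1) * D) (μ i)

/-- **`dim {λ}^H`**: the dimension of the space of `H`-invariants (Mathlib
`Representation.invariants`) of the Weyl module `{λ} = weylRep k (Fin N) λ` restricted to a
subgroup `H ≤ GL_N` (IK §9, TeX L792: "`HWV_{λ^*}(ℂ[G]^{H}) ≃ {λ}^H`"; §2: "the dimension of the
spaces of `H_p`- and `H_q`-invariants in irreducible `GL_m`-representations"). This is the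
tree-side rendering of `mult_{λ^*} ℂ[Gp]` for `H = stab p`, see the module docstring
("dictionary"). [cite: IkenmeyerKandasamy2019, §9 eq. (9.4)] -/
def weylInvariantDim (k : Type*) [Field k] (N : ℕ) {n : ℕ} (lam : Nat.Partition n)
    (H : Subgroup (GL (Fin N) k)) : ℕ :=
  Module.finrank k
    (Representation.invariants (k := k) (G := H) (V := weylModule k (Fin N) lam)
      ((weylRep k (Fin N) lam).comp H.subtype))

end IK2020

open IK2020

/-- NAMED FACT (**Ikenmeyer–Kandasamy 2020, Prop. 4.1**, TeX L372–382; chunk p0008.txt:L6–17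
'Proposition 1'): "Let `λ ⊢_m dD`. Define `b(λ,ϱ,D,d) := ∑ … c^λ_{μ¹,…,μ^d} ∏ a_{μ^i}(ρ̂_i,iD)`.
Then `mult_{λ^*} ℂ[Gp] = ∑_{ϱ ⊢_m d} b(λ,ϱ,D,d)`." Here `p = x₁^D + ⋯ + x_m^D`, `G = GL_m`.
RENDERING: the orbit's coordinate ring `ℂ[Gp]` is not in the tree; by IK's (9.3)–(9.4)
(`ℂ[Gp] ≅ ℂ[G]^{H}`, `HWV_{λ^*}(ℂ[G]^{H}) ≃ {λ}^H`, `H = stab p`; §9, TeX L769–798) the left side is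
`dim {λ}^H = weylInvariantDim ℂ m λ (linStabilizer p)` — this def states Prop. 4.1 through that
printed identification. Standing hypotheses `3 ≤ D ≤ m` of §§2–3 kept. Proof in print: §10
(Thm. 9.1 + Prop. 10.1). -- FACT (R1: Schur–Weyl duality, Specht modules `{λ}^ϱ ≃ [λ]^{G_ϱ}`).
[cite: IkenmeyerKandasamy2019, Prop. 4.1] -/
def IK2020_prop_4_1 : Prop :=
  ∀ (m D d : ℕ), 3 ≤ D → D ≤ m → ∀ (lam : Nat.Partition (d * D)), lam.parts.card ≤ m →
    weylInvariantDim ℂ m lam (linStabilizer (psum (Fin m) ℂ D)) =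
      ∑ ρ ∈ (Finset.univ : Finset (Nat.Partition d)).filter (fun ρ => ρ.parts.card ≤ m),
        bCoeff ℂ m D d lam ρ

namespace IK2020

/-! ## Thm. 4.2: the Main Technical Theorem -/

/-- Ceiling division `⌈a / b⌉` on `ℕ`, as `(a + (b - 1)) / b` (junk `0` for `b = 0`; only used
with `b = D - 2 ≥ 1` resp. `2(D-2) ≥ 2`). [folklore] -/
def ceilDiv (a b : ℕ) : ℕ :=
  (a + (b - 1)) / b

/-- **IK's `e_ϱ`** (Thm. 4.2, TeX L393–397; chunk p0008.txt:L31–35; and Thm. 13.1, TeX L1131–1134):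
"if `D` is even, let `e_ϱ := ∑_{i=1}^m ⌈ϱ_i/(D-2)⌉`; if `D` is odd, let
`e_ϱ := ∑_{i=1}^m 2⌈ϱ_i/(2(D-2))⌉`", as a function of the multiset of parts of `ϱ` (zero parts
contribute `0`, so padding `ϱ` to `m` entries does not matter). [cite: IkenmeyerKandasamy2019, Thm. 4.2] -/
def eRho (D : ℕ) (ρ : Multiset ℕ) : ℕ :=
  if Even D then (ρ.map fun r => ceilDiv r (D - 2)).sum
  else (ρ.map fun r => 2 * ceilDiv r (2 * (D - 2))).sum

/-- **IK's `e_Ξ := max {e_ϱ | ϱ ∈ Ξ}`** for a set `Ξ` of partitions of `d` (Thm. 4.2, TeX L398–399;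
chunk p0008.txt:L37–38). Junk: `e_∅ = 0` (the printed `Ξ` is nonempty in every use).
[cite: IkenmeyerKandasamy2019, Thm. 4.2] -/
def eXi (D : ℕ) {d : ℕ} (Ξ : Finset (Nat.Partition d)) : ℕ :=
  Ξ.sup fun ρ => eRho D ρ.parts

/-- The partition `λ + (m × c)` (row-wise sum with the rectangle of `m` rows of length `c`,
IK §3, TeX L312–313: "`(λ+μ)_i := λ_i + μ_i`", "`a × b := (b, b, …, b)` with `a` rows"), for `λ`
with at most `m` parts: parts `λ_i + c` (`i ≤ m`, `λ` padded by zeros). Built with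
`Nat.Partition.ofSums` (which drops the zero parts arising when `c = 0`). Its dual weight is
`(λ + (m × c))^* = λ^* - (c, …, c)`; this is how the shifted types `(λ + (m × e D))^*` of
Thm. 4.2 / Lemma 5.1 / Lemma 5.2 are formed. [cite: IkenmeyerKandasamy2019, §3] -/
def addRect {n : ℕ} (lam : Nat.Partition n) (m c : ℕ) (h : lam.parts.card ≤ m) :
    Nat.Partition (n + m * c) :=
  Nat.Partition.ofSums (n + m * c)
    (lam.parts.map (· + c) + Multiset.replicate (m - lam.parts.card) c) (by
      simp only [Multiset.sum_add, Multiset.sum_map_add, Multiset.map_id', Multiset.map_const',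
        Multiset.sum_replicate, smul_eq_mul, lam.parts_sum]
      have : lam.parts.card + (m - lam.parts.card) = m := Nat.add_sub_cancel' h
      rw [add_assoc, ← Nat.add_mul, this])

end IK2020

/-- NAMED FACT (**Ikenmeyer–Kandasamy 2020, Thm. 4.2, Main Technical Theorem**, TeX L390–402;
chunk p0008.txt:L27–43 'Theorem 2'): "Let `m, d, D ∈ ℕ`. If `D` is odd, we assume that
`binom(2(D-1), D-1) ≥ 2(m-1)`. Let `λ ⊢_m dD`. For each `ϱ ⊢_m d` define the number `e_ϱ` as
follows: if `D` is even, let `e_ϱ := ∑_{i=1}^m ⌈ϱ_i/(D-2)⌉`; if `D` is odd, let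
`e_ϱ := ∑_{i=1}^m 2⌈ϱ_i/(2(D-2))⌉`. Let `Ξ` be a subset of the set of all partitions `ϱ ⊢_m d`.
Let `e_Ξ := max{e_ϱ | ϱ ∈ Ξ}`. Then
`mult_{(λ+(m × e_Ξ D))^*} ℂ[\overline{Gp}] ≥ ∑_{ϱ ∈ Ξ} b(λ,ϱ,D,d)`." (`p = x₁^D + ⋯ + x_m^D`,
`G = GL_m`.) The type `(λ + (m × e_Ξ D))^*` is `Weight.dualOfPartition m (addRect λ m (e_Ξ D) _)`;
standing hypotheses `3 ≤ D ≤ m` (§§2–3) kept.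
-- FACT (XL: §§9–13 and the Tableau Lifting Theorem, §§14–21).
[cite: IkenmeyerKandasamy2019, Thm. 4.2] -/
def IK2020_thm_4_2 : Prop :=
  ∀ (m d D : ℕ), 3 ≤ D → D ≤ m → (Odd D → 2 * (m - 1) ≤ Nat.choose (2 * (D - 1)) (D - 1)) →
    ∀ (lam : Nat.Partition (d * D)) (h : lam.parts.card ≤ m)
      (Ξ : Finset (Nat.Partition d)), (∀ ρ ∈ Ξ, ρ.parts.card ≤ m) →
      ∑ ρ ∈ Ξ, bCoeff ℂ m D d lam ρ ≤
        orbitMultiplicity ℂ (psum (Fin m) ℂ D) D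
          (Weight.dualOfPartition m (addRect lam m (eXi D Ξ * D) h))

/-- NAMED FACT (**Ikenmeyer–Kandasamy 2020, Cor. 4.5**, TeX L483–488; chunk p0008.txt:L128–133
'Corollary 4'): "Let `D ≥ 3` be odd and let `m` be arbitrary with `binom(2(D-1), D-1) ≥ 2(m-1)`.
Let `d` be arbitrary. Let `e = 2⌈d/(2(D-2))⌉`. Then `a_{(dD)+m×eD}(d+me, D) ≥ 1`." — positivity of
the plethysm coefficient of the partition `(dD) + (m × eD) = (dD + eD, eD, …, eD)` (`m` parts) of
`(d + me) D` in `Sym^{d+me} Sym^D ℂ^m` (tree `plethysmCoeffOfPartition ℂ m D`, the outer degree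
`d + me` being pinned by the size). "`m` arbitrary" is read with the standing assumption `m ≥ D` of
§2 (p0005.txt:L4) kept as a hypothesis; for `m ≥ 1` the one-row partition `(dD)` has at most `m`
parts. -- FACT (printed proof: Thm. 4.2 with `Ξ = {(d)}`, `b((dD),(d),D,d) = 1`).
[cite: IkenmeyerKandasamy2019, Cor. 4.5] -/
def IK2020_cor_4_5 : Prop :=
  ∀ (m d D : ℕ) (hD : 3 ≤ D), Odd D → ∀ (hm : D ≤ m),
    2 * (m - 1) ≤ Nat.choose (2 * (D - 1)) (D - 1) →
      1 ≤ plethysmCoeffOfPartition ℂ m D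
        (addRect (Nat.Partition.indiscrete (d * D)) m (2 * ceilDiv d (2 * (D - 2)) * D)
          ((card_parts_indiscrete_le_one _).trans (le_trans (by norm_num) (hD.trans hm))))

/-! ## §5: Lemma 5.1 [BI:17] and Lemma 5.2 -/

/-- NAMED FACT (**Ikenmeyer–Kandasamy 2020, Lemma 5.1**, quoted from [BI:17] = Bürgisser–Ikenmeyer,
*Fundamental invariants of orbit closures* (2017); TeX L506–509; chunk p0010.txt:L9–11 'Lemma 5
([BI:17])'): "If `D` is even, then `mult_{λ^*} ℂ[Gp] = mult_{(λ+(m×D))^*} ℂ[Gp]`. If `D` is odd, then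
`mult_{λ^*} ℂ[Gp] = mult_{(λ+(m×2D))^*} ℂ[Gp]`." (`p = x₁^D + ⋯ + x_m^D`, `G = GL_m`, `λ ⊢_m dD`.)
RENDERING via (9.4): both sides as `dim {·}^H`, `H = stab p = linStabilizer p`, i.e.
`dim {λ}^H = dim {λ + (m × D)}^H` resp. `… (m × 2D)` (`{λ+(m×c)} = {λ} ⊗ det^c`, and `det^D`
resp. `det^{2D}` is trivial on `H`). Standing hypotheses `3 ≤ D ≤ m` kept. -- FACT (BI17 typer
t04 may land the [BI:17] original; then this becomes a citation).
[cite: IkenmeyerKandasamy2019, Lemma 5.1] -/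
def IK2020_lemma_5_1 : Prop :=
  ∀ (m D d : ℕ), 3 ≤ D → D ≤ m → ∀ (lam : Nat.Partition (d * D)) (h : lam.parts.card ≤ m),
    (Even D →
      weylInvariantDim ℂ m lam (linStabilizer (psum (Fin m) ℂ D)) =
        weylInvariantDim ℂ m (addRect lam m D h) (linStabilizer (psum (Fin m) ℂ D))) ∧
    (Odd D →
      weylInvariantDim ℂ m lam (linStabilizer (psum (Fin m) ℂ D)) =
        weylInvariantDim ℂ m (addRect lam m (2 * D) h) (linStabilizer (psum (Fin m) ℂ D)))

namespace IK2020

/-- **IK's `e` of Lemma 5.2** (TeX L512–525; chunk p0010.txt:L13–30 'Lemma 6'): for `D` even,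
`e := d` if `d ≤ m` and `e := m + ⌊(d-m)/(D-2)⌋` if `d ≥ m`; for `D` odd, `e := 2d` if `d ≤ m` and
`e := 2m + 2⌊(d-m)/(2(D-2))⌋` if `d ≥ m` (the two branches agree at `d = m`).
[cite: IkenmeyerKandasamy2019, Lemma 5.2] -/
def eCormain (m d D : ℕ) : ℕ :=
  if Even D then (if d ≤ m then d else m + (d - m) / (D - 2))
  else (if d ≤ m then 2 * d else 2 * m + 2 * ((d - m) / (2 * (D - 2))))

end IK2020

/-- NAMED FACT (**Ikenmeyer–Kandasamy 2020, Lemma 5.2, first equality**, TeX L510–527; chunk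
p0010.txt:L13–30 'Lemma 6'): "Let `λ ⊢_m dD`. If `D` is even, let `e := d` (`d ≤ m`),
`m + ⌊(d-m)/(D-2)⌋` (`d ≥ m`). If `D` is odd and `binom(2(D-1),D-1) ≥ 2(m-1)`, let `e := 2d` (`d ≤ m`),
`2m + 2⌊(d-m)/(2(D-2))⌋` (`d ≥ m`). In both cases we have
`mult_{(λ+(m×eD))^*} ℂ[\overline{Gp}] = mult_{λ^*} ℂ[Gp] (= mult_{(λ+(m×eD))^*} ℂ[Gp])`."
Left side: tree `orbitMultiplicity` of the CLOSURE at the type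
`Weight.dualOfPartition m (addRect λ m (eD) _)`; right side RENDERED via (9.4) as
`dim {λ}^H = weylInvariantDim ℂ m λ (linStabilizer p)` (module docstring). The printed second
equality is Lemma 5.1 (`IK2020_lemma_5_1`). Standing hypotheses `3 ≤ D ≤ m` kept.
-- FACT (printed proof: Thm. 4.2 with `Ξ` = all `ϱ ⊢_m d`, Prop. 4.1, Lemma 5.1).
[cite: IkenmeyerKandasamy2019, Lemma 5.2] -/
def IK2020_lemma_5_2 : Prop :=
  ∀ (m d D : ℕ), 3 ≤ D → D ≤ m → (Odd D → 2 * (m - 1) ≤ Nat.choose (2 * (D - 1)) (D - 1)) →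
    ∀ (lam : Nat.Partition (d * D)) (h : lam.parts.card ≤ m),
      orbitMultiplicity ℂ (psum (Fin m) ℂ D) D
          (Weight.dualOfPartition m (addRect lam m (eCormain m d D * D) h)) =
        weylInvariantDim ℂ m lam (linStabilizer (psum (Fin m) ℂ D))

/-! ## §8: tableau contraction — `γ(gT)` as a product of column determinants -/

namespace IK2020

/-- The factor of one column in eq. (8.2) (Lemma 8.1, TeX L676–686; chunk p0014.txt:L7–18
'Lemma 8'): for a column of height `j ≤ m` with entries `T(1,c), …, T(j,c) ∈ [m]` and
`g ∈ ℂ^{m×m}`, `det(g_{1..j, T(1,c)}, …, g_{1..j, T(j,c)})`, the determinant of the `j × j` matrix whose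
`r`-th column consists of the top `j` entries of column `T(r,c)` of `g` ("A determinant of a
matrix with more rows than columns is defined as the determinant of the square matrix of its top
rows", TeX L678). [cite: IkenmeyerKandasamy2019, Lemma 8.1] -/
def colTopDet (k : Type*) [CommRing k] {m : ℕ} (g : Matrix (Fin m) (Fin m) k) {j : ℕ} (hj : j ≤ m)
    (col : Fin j → Fin m) : k :=
  (Matrix.of fun i r : Fin j => g (Fin.castLE hj i) (col r)).det

/-- **`γ(gT)`, eq. (8.2)** (Lemma 8.1, TeX L680–686, and Cor. 8.3, TeX L705–708 'Corollary 9':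
"`γ(gT) = ∏_{c=1}^{λ₁} γ(g col_c)`"): for a tableau given column by column (`C` columns of
heights `h c ≤ m`, entries `T c r ∈ [m]`), `∏_c det(g_{1..h_c, T(1,c)}, …, g_{1..h_c, T(h_c,c)})`. In
print `γ ∈ {λ}^*` is the vector dual to the superstandard tableau in the semistandard basis of
`{λ} = ⊗^{|λ|}ℂ^m / K(λ)` and (8.2) is a LEMMA; the tree has no tableau basis of `{λ}`, so — as in
its tableau calculus `TableauEval.TabM.EC` / `EC_powers` — (8.2) is taken as the DEFINITION of
`γ(gT)`, and Cor. 8.3 holds by `rfl`. [cite: IkenmeyerKandasamy2019, Lemma 8.1 eq. (8.2)] -/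
def gammaProd (k : Type*) [CommRing k] {m C : ℕ} (g : Matrix (Fin m) (Fin m) k) (h : Fin C → ℕ)
    (hh : ∀ c, h c ≤ m) (T : (c : Fin C) → Fin (h c) → Fin m) : k :=
  ∏ c, colTopDet k g (hh c) (T c)

end IK2020

/-- **Ikenmeyer–Kandasamy 2020, Cor. 8.4** (TeX L712–715; chunk p0014.txt:L55–58 'Corollary 10'):
"For a tableau `T` that consists of a single regular column of `m` boxes, we have
`γ(gT) ∈ {-det(g), det(g)}`." (regular = no repeated entry, i.e. the column is a bijection onto
`[m]`.) PROVED (Mathlib `Matrix.det_permute'`). -- DISCHARGEABLE, done.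
[cite: IkenmeyerKandasamy2019, Cor. 8.4] -/
theorem IK2020_cor_8_4 (k : Type*) [CommRing k] {m : ℕ} (g : Matrix (Fin m) (Fin m) k)
    (col : Fin m → Fin m) (hcol : Function.Bijective col) :
    colTopDet k g le_rfl col = g.det ∨ colTopDet k g le_rfl col = -g.det := by
  have hM : (Matrix.of fun i r : Fin m => g (Fin.castLE le_rfl i) (col r)) =
      g.submatrix id (Equiv.ofBijective col hcol) := by
    ext i r
    rfl
  have h : colTopDet k g le_rfl col =
      ((Equiv.Perm.sign (Equiv.ofBijective col hcol) : ℤ) : k) * g.det := by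
    unfold colTopDet
    rw [hM, Matrix.det_permute']
  rcases Int.units_eq_one_or (Equiv.Perm.sign (Equiv.ofBijective col hcol)) with h1 | h1
  · left; rw [h, h1]; simp
  · right; rw [h, h1]; simp

/-- **Ikenmeyer–Kandasamy 2020, Cor. 8.4, second sentence** (TeX L714): "In particular, if
`g ∈ SL_m`, we have `γ(gT) ∈ {-1, 1}`." PROVED. [cite: IkenmeyerKandasamy2019, Cor. 8.4] -/
theorem IK2020_cor_8_4_sl (k : Type*) [CommRing k] {m : ℕ} (g : Matrix (Fin m) (Fin m) k)
    (hg : g.det = 1) (col : Fin m → Fin m) (hcol : Function.Bijective col) :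
    colTopDet k g le_rfl col = 1 ∨ colTopDet k g le_rfl col = -1 := by
  rw [← hg]
  exact IK2020_cor_8_4 k g col hcol

/-- **Ikenmeyer–Kandasamy 2020, Cor. 8.5** (TeX L719–721; chunk p0014.txt:L63–64 'Corollary 11'):
"If `T` is not regular, then `γ(gT) = 0`, independent of `g`." (A column with a repeated entry
gives a determinant with two equal columns, Lemma 8.1.) PROVED for `gammaProd`.
-- DISCHARGEABLE, done. [cite: IkenmeyerKandasamy2019, Cor. 8.5] -/
theorem IK2020_cor_8_5 (k : Type*) [CommRing k] {m C : ℕ} (g : Matrix (Fin m) (Fin m) k)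
    (h : Fin C → ℕ) (hh : ∀ c, h c ≤ m) (T : (c : Fin C) → Fin (h c) → Fin m)
    (hT : ∃ c, ¬ Function.Injective (T c)) : gammaProd k g h hh T = 0 := by
  obtain ⟨c, hc⟩ := hT
  apply Finset.prod_eq_zero (Finset.mem_univ c)
  unfold colTopDet
  obtain ⟨a, b, hab, hne⟩ : ∃ a b, T c a = T c b ∧ a ≠ b := by
    simpa [Function.Injective] using hc
  exact Matrix.det_zero_of_column_eq hne (fun i => by simp [hab])

/-! ## §10: Prop. 10.1 and Claim 10.2 (the `𝔖_m`-invariants of `{λ}_ϱ`) -/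

namespace IK2020

/-- A permutation `π ∈ 𝔖_m` as an element of `GL_m` (the permutation matrix with
`e_i ↦ e_{π(i)}`; IK §7, TeX L650: "We embed `𝔖_m ⊆ G` via permutation matrices").
[cite: IkenmeyerKandasamy2019, §7] -/
def permGL (k : Type*) [Field k] {m : ℕ} (π : Equiv.Perm (Fin m)) : GL (Fin m) k :=
  Matrix.GeneralLinearGroup.mkOfDetNeZero (π⁻¹.permMatrix k) (by
    rw [Matrix.det_permutation]
    rcases Int.units_eq_one_or (Equiv.Perm.sign π⁻¹) with h | h <;> simp [h])

/-- **`{λ}_ϱ`** (Prop. 10.1, TeX L850–851; chunk p0016.txt:L8–10 'Proposition 15'): "the linear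
subspace spanned by the tableaux whose sorted content is `ϱD`" of the `GL_m`-module `{λ}` — i.e.
the sum of the weight spaces (tree `weightSpace`) of `{λ} = weylRep k (Fin m) λ` for the weights
`D·(ϱ ∘ π)`, `π ∈ 𝔖_m` (`ϱ` padded with zeros to `m` entries, `Weight.ofPartition m ϱ`; a
tableau of content `γ` is a weight vector of weight `γ`, §6). [cite: IkenmeyerKandasamy2019, Prop. 10.1] -/
def contentSubspace (k : Type*) [Field k] (m D : ℕ) {n d : ℕ} (lam : Nat.Partition n)
    (ρ : Nat.Partition d) : Submodule k (weylModule k (Fin m) lam) :=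
  ⨆ π : Equiv.Perm (Fin m),
    weightSpace (V := weylModule k (Fin m) lam) (weylRep k (Fin m) lam)
      (fun i => (D : ℤ) * Weight.ofPartition m ρ (π i))

/-- The subspace of a subspace `W ⊆ {λ}` fixed by a set `S ⊆ 𝔖_m` of permutation matrices
(`W^{S}`; for `S = 𝔖_m` the `𝔖_m`-invariants `W^{𝔖_m}`, §7, TeX L654).
[cite: IkenmeyerKandasamy2019, §7] -/
def permFixed (k : Type*) [Field k] {m n : ℕ} (lam : Nat.Partition n)
    (S : Set (Equiv.Perm (Fin m))) (W : Submodule k (weylModule k (Fin m) lam)) :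
    Submodule k (weylModule k (Fin m) lam) :=
  W ⊓ ⨅ π ∈ S, LinearMap.eqLocus (weylRep k (Fin m) lam (permGL k π)) LinearMap.id

end IK2020

/-- NAMED FACT (**Ikenmeyer–Kandasamy 2020, Prop. 10.1**, TeX L850–854; chunk p0016.txt:L8–12
'Proposition 15'): "Let `{λ}_ϱ ⊆ {λ}` denote the linear subspace spanned by the tableaux whose
sorted content is `ϱD`. Then `dim ({λ}_ϱ)^{𝔖_m} = b(λ,ϱ,D,d)`." (Context of §10 = proof of
Prop. 4.1: `λ ⊢_m dD`, `ϱ ⊢_m d`, `G = GL_m`.) Standing hypotheses `3 ≤ D ≤ m` kept.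
-- FACT (R1: `{λ}^ϱ ≃ [λ]^{G_ϱ}` [ike:12b, 4.3(A)] and Schur–Weyl duality).
[cite: IkenmeyerKandasamy2019, Prop. 10.1] -/
def IK2020_prop_10_1 : Prop :=
  ∀ (m D d : ℕ), 3 ≤ D → D ≤ m → ∀ (lam : Nat.Partition (d * D)), lam.parts.card ≤ m →
    ∀ (ρ : Nat.Partition d), ρ.parts.card ≤ m →
      Module.finrank ℂ (permFixed ℂ lam Set.univ (contentSubspace ℂ m D lam ρ)) =
        bCoeff ℂ m D d lam ρ

/-- NAMED FACT (**Ikenmeyer–Kandasamy 2020, Claim 10.2**, TeX L862–864; chunk p0016.txt:L20–21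
'Claim 16'): "`dim ({λ}_ϱ)^{𝔖_m} = dim ({λ}^ϱ)^{stab ϱ}`", where (TeX L856–860) "`{λ}^ϱ` denote[s] the
`ϱ`-weight space, i.e., the linear space spanned by tableaux of shape `λ` and content `ϱ`"
[read: content `Dϱ`, the summand of `{λ}_ϱ = ⊕_{γ ∈ 𝔖_m ϱ} {λ}^γ` at `γ = ϱ`] and
"`stab ϱ ≤ 𝔖_m` denote[s] the stabilizer of `ϱ`". Standing hypotheses as in Prop. 10.1.
-- FACT, DISCHARGEABLE (R2: finite linear algebra — `𝔖_m` permutes the weight spaces).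
[cite: IkenmeyerKandasamy2019, Claim 10.2] -/
def IK2020_claim_10_2 : Prop :=
  ∀ (m D d : ℕ), 3 ≤ D → D ≤ m → ∀ (lam : Nat.Partition (d * D)), lam.parts.card ≤ m →
    ∀ (ρ : Nat.Partition d), ρ.parts.card ≤ m →
      Module.finrank ℂ (permFixed ℂ lam Set.univ (contentSubspace ℂ m D lam ρ)) =
        Module.finrank ℂ (permFixed ℂ lam
          {π | ∀ i, Weight.ofPartition m ρ (π i) = Weight.ofPartition m ρ i}
          (weightSpace (V := weylModule ℂ (Fin m) lam) (weylRep ℂ (Fin m) lam)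
            (fun i => (D : ℤ) * Weight.ofPartition m ρ i)))

/-! ## §11: Thm. 11.1, first assertion (proved) -/

/-- **Ikenmeyer–Kandasamy 2020, Thm. 11.1, first assertion** (TeX L940–942; chunk p0017.txt:L8–10
'Theorem 17'): "If `|λ|` is not divisible by `D`, then `HWV_{λ^*}(ℂ[\overline{Gp}]) = 0`."
(`p = x₁^D + ⋯ + x_m^D`, `λ` a partition with at most `m` parts.) PROVED from the tree's
`nonpos_and_exists_size_eq_of_hasHighestWeight_orbitCoordRep` ("a weight pins the degree":
every highest weight of `ℂ[\overline{GL·f}]` has size `-D·δ`), as in print ("`ℂ[\overline{Gp}]` is a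
graded subalgebra of `ℂ[Sym^Dℂ^m]` … the only types `λ^*` that occur satisfy `λ ⊢ δD`"). The last
assertion of Thm. 11.1 is the tree's `TableauEval.TabM.tabPoly_mem_highestWeightSpace` with the
formula `TableauEval.TabM.EC_powers`. -- DISCHARGEABLE, done. [cite: IkenmeyerKandasamy2019, Thm. 11.1] -/
theorem IK2020_thm_11_1_1 {m D n : ℕ} (lam : Nat.Partition n) (hlam : lam.parts.card ≤ m)
    (hn : ¬ D ∣ n) :
    highestWeightSpace (orbitCoordRep (psum (Fin m) ℂ D) D) (Weight.dualOfPartition m lam) = ⊥ := by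
  by_contra h
  obtain ⟨-, δ, hδ⟩ := nonpos_and_exists_size_eq_of_hasHighestWeight_orbitCoordRep _ h
  rw [Weight.dualOfPartition, Weight.size_dual, Weight.size_ofPartition_holds hlam] at hδ
  have h' : (n : ℤ) = ((D * δ : ℕ) : ℤ) := by linarith
  exact hn ⟨δ, by exact_mod_cast h'⟩

/-! ## §12: Prop. 12.1 (proved from the tree) -/

/-- **Ikenmeyer–Kandasamy 2020, Prop. 12.1** (TeX L1040–1043; chunk p0018.txt:L5–7
'Proposition 18'): "Let `ν = (2m) + m × 2m`. Then `a_ν(2(m+1), m) > 2`." — with `m = D ≥ 4` even as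
in Thm. 4.3 / Prop. 5.3, whose "missing part" §12 proves (`ν = ikPartition m = (4m, 2m, …, 2m)`,
`a_ν(2(m+1), m) = plethysmCoeffOfPartition ℂ m m ν`). PROVED from the tree theorems
`IK2020_thm_4_3_holds` (`2 ≤ mult_{ν^*} ℂ[\overline{Gp}]`) and `IK2020_prop_5_3_1_holds`
(`mult_{ν^*} ℂ[\overline{Gp}] < a_ν(2(m+1),m)`) — the printed proof runs the other way round (two
non-vanishing functions from Thm. 4.2 plus the Waring-rank equation `f`, Claim 12.2 =
`IK2020.ikPoly_ne_zero`, whose tableau `T_right` carries the print erratum recorded in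
`PowerSumWaringRankEquation.lean`). -- DISCHARGEABLE, done. [cite: IkenmeyerKandasamy2019, Prop. 12.1] -/
theorem IK2020_prop_12_1 (m : ℕ) (h4 : 4 ≤ m) (he : Even m) :
    2 < plethysmCoeffOfPartition ℂ m m (ikPartition m) := by
  have h1 := (IK2020_thm_4_3_holds m h4 he).1
  have h2 := IK2020_prop_5_3_1_holds m h4 he
  omega

/-! ## §13: the Tableau Lifting Theorem -/

namespace IK2020

/-- A tableau given COLUMN BY COLUMN over an alphabet `α`: `C` columns, column `c` of height
`h c`, entry `entry c r` in row `r` of column `c` (IK §3, TeX L323: "A tableau of shape `λ` over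
some finite alphabet `𝒜` is a mapping `λ → 𝒜` of boxes"; the shape is recorded by its column
lengths `λᵗ`, TeX L309–310). The same column-wise format as the tree's `TableauEval.TabM`.
[cite: IkenmeyerKandasamy2019, §3] -/
structure ColTableau (α : Type*) where
  /-- number of columns (`= λ₁`) -/
  C : ℕ
  /-- column heights (`= λᵗ`) -/
  h : Fin C → ℕ
  /-- the entry in column `c`, row `r` -/
  entry : (c : Fin C) → Fin (h c) → α

namespace ColTableau

variable {α β : Type*}

/-- `T` has shape `λ ⊢_m n` recorded by columns: heights weakly decreasing, positive, at most
`m` (at most `m` rows) and `n` boxes in total (IK §3, TeX L304–311). [cite: IkenmeyerKandasamy2019, §3] -/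
def IsShape (T : ColTableau α) (m n : ℕ) : Prop :=
  Antitone T.h ∧ (∀ c, 0 < T.h c ∧ T.h c ≤ m) ∧ ∑ c, T.h c = n

/-- A tableau is **regular** if no column has a repeated entry (IK §3, TeX L327: "A column of a
tableau `T` is called regular if it does not have a repeated entry. A tableau `T` is called
regular if each of its columns is regular."). [cite: IkenmeyerKandasamy2019, §3] -/
def IsRegular (T : ColTableau α) : Prop :=
  ∀ c, Function.Injective (T.entry c)

/-- The number of occurrences of the symbol `a` in `T` (its content at `a`, IK §3, TeX L323:
"content … `ϱ_i` counts the number of occurrences of `i` in `T`"). [cite: IkenmeyerKandasamy2019, §3] -/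
def count [DecidableEq α] (T : ColTableau α) (a : α) : ℕ :=
  ∑ c, (Finset.univ.filter fun r : Fin (T.h c) => T.entry c r = a).card

/-- Relabelling the entries along `φ : α → β` — IK's `φT` (§7, TeX L662: "we define `φT` as the
tableau that is the result of replacing the entries"), and for `φ = π ∈ 𝔖_m` the tableau `πS`.
[cite: IkenmeyerKandasamy2019, §7] -/
def relabel (φ : α → β) (T : ColTableau α) : ColTableau β :=
  ⟨T.C, T.h, fun c r => φ (T.entry c r)⟩

/-- A tableau is **duplex** if each column appears an even number of times (IK §3, TeX L328;
chunk p0006.txt:L27: "A tableau `L` is called duplex if each column in `L` appears an even number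
of times"): for every column `c`, the number of columns `c'` equal to it (same height, same
entries) is even. [cite: IkenmeyerKandasamy2019, §3] -/
def IsDuplex [DecidableEq α] (T : ColTableau α) : Prop :=
  ∀ c, Even ((Finset.univ.filter fun c' : Fin T.C =>
    ∃ e : T.h c' = T.h c, ∀ r : Fin (T.h c'), T.entry c' r = T.entry c (Fin.cast e r)).card)

end ColTableau

/-- The `m × E` rectangular LEFT PART of a lifted tableau, as a column tableau: `E` columns of
height `m` (§13, TeX L1125: "`leftpart(T)` … the `m × e` rectangular subtableau consisting of the
leftmost `e` columns"). [cite: IkenmeyerKandasamy2019, §13] -/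
def rectTableau {α : Type*} {m E : ℕ} (L : Fin E → Fin m → α) : ColTableau α :=
  ⟨E, fun _ => m, L⟩

end IK2020

/-- NAMED FACT (**Ikenmeyer–Kandasamy 2020, Thm. 13.1, Tableau Lifting Theorem**, TeX L1128–1144;
chunk p0019.txt:L11–26 'Theorem 20'): "Let `D ≥ 3` and `m ≥ 2`. Given a regular tableau `S` of
shape `λ ⊢_m dD` and content `Dϱ` for `ϱ ⊢_m d`. Let `e_ϱ := ∑_{i=1}^m ⌈ϱ_i/(D-2)⌉` in the case where
`D` is even and `e_ϱ := ∑_{i=1}^m 2⌈ϱ_i/(2(D-2))⌉` in the case where `D` is odd and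
`binom(2(D-1),D-1) ≥ 2(m-1)`. Let `δ := m e_ϱ + d`. In both cases there exists a tableau
`T : λ + (m × e_ϱ D) → {1,…,δ}` in which every entry appears exactly `D` many times such that
(1) for each `φ ∈ ℳ_{δ,m}` for which `φ(T)` is regular we have that `rightpart(φ(T)) ∈ 𝔖_m S`,
(2) for each `φ ∈ ℳ_{δ,m}` for which `φ(T)` is regular we have that `leftpart(φ(T))` is duplex,
(3) there exists `φ ∈ ℳ_{δ,m}` such that `φ(T)` is regular and `rightpart(φ(T)) = S`."
RENDERING: `S : ColTableau (Fin m)` with `S.IsShape m (dD)`; content `Dϱ` with `ϱ ∈ ℕ^m`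
antitone, `∑ ϱ_i = d` (= `ϱ ⊢_m d` padded, §13 TeX L1126); `T = leftpart(T) + rightpart(T)`
(TeX L1125) is given as the PAIR (`L` = the `m × e_ϱD` rectangle as `e_ϱ D` columns of height `m`,
`R` = a tableau of the shape of `S`) over the alphabet `Fin δ`; `ℳ_{δ,m}` = all maps
`φ : Fin δ → Fin m` (§7, TeX L665); `φ(T)` regular = both parts regular; `𝔖_m S = {πS}`. For odd
`D` the binomial condition is a hypothesis. -- FACT (L/XL: §§14–21, ≈ 60 pp. of tableau
combinatorics; purely finite, no missing theory). [cite: IkenmeyerKandasamy2019, Thm. 13.1] -/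
def IK2020_thm_13_1 : Prop :=
  ∀ (D m d : ℕ), 3 ≤ D → 2 ≤ m → (Odd D → 2 * (m - 1) ≤ Nat.choose (2 * (D - 1)) (D - 1)) →
    ∀ (S : ColTableau (Fin m)), S.IsShape m (d * D) → S.IsRegular →
    ∀ (ρ : Fin m → ℕ), Antitone ρ → ∑ i, ρ i = d → (∀ i, S.count i = D * ρ i) →
      let E := eRho D (Finset.univ.val.map ρ) * D
      let δ := m * eRho D (Finset.univ.val.map ρ) + d
      ∃ (L : Fin E → Fin m → Fin δ) (R : (c : Fin S.C) → Fin (S.h c) → Fin δ),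
        (∀ u : Fin δ, (rectTableau L).count u + (ColTableau.mk S.C S.h R).count u = D) ∧
        (∀ φ : Fin δ → Fin m,
          (rectTableau fun c r => φ (L c r)).IsRegular →
          ((ColTableau.mk S.C S.h R).relabel φ).IsRegular →
            (∃ π : Equiv.Perm (Fin m), (ColTableau.mk S.C S.h R).relabel φ = S.relabel π) ∧
            (rectTableau fun c r => φ (L c r)).IsDuplex) ∧
        (∃ φ : Fin δ → Fin m,
          (rectTableau fun c r => φ (L c r)).IsRegular ∧
          ((ColTableau.mk S.C S.h R).relabel φ).IsRegular ∧
          (ColTableau.mk S.C S.h R).relabel φ = S)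


/-! ## Thm. 4.3's instance of Thm. 4.2's data (proved bookkeeping) -/

namespace IK2020

/-- The partition `(1,1) ⊢ 2` (IK Thm. 4.3: "`Ξ = {(2),(1,1)}`"). [cite: IkenmeyerKandasamy2019, Thm. 4.3] -/
def twoOnes : Nat.Partition 2 :=
  Nat.Partition.ofSums 2 {1, 1} (by simp)

/-- The parts of `(1,1)`. [cite: IkenmeyerKandasamy2019, Thm. 4.3] -/
theorem twoOnes_parts : twoOnes.parts = {1, 1} := by
  decide

/-- **Ikenmeyer–Kandasamy 2020, Thm. 4.3, the sentence "In the notation of Theorem 4.2 we have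
`e_{(2)} = 1` and `e_{(1,1)} = 2`, thus `e_Ξ = 2`"** (TeX L417; chunk p0008.txt:L54–55), for
`m = D ≥ 4` even and `Ξ = {(2), (1,1)}`, checked on the tree's `eRho` / `eXi`. PROVED.
[cite: IkenmeyerKandasamy2019, Thm. 4.3] -/
theorem eRho_eXi_thm_4_3 (m : ℕ) (h4 : 4 ≤ m) (he : Even m) :
    eRho m (Nat.Partition.indiscrete 2).parts = 1 ∧ eRho m twoOnes.parts = 2 ∧
      eXi m ({Nat.Partition.indiscrete 2, twoOnes} : Finset (Nat.Partition 2)) = 2 := by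
  have h1 : eRho m (Nat.Partition.indiscrete 2).parts = 1 := by
    rw [Nat.Partition.indiscrete_parts (by norm_num), eRho, if_pos he]
    simp only [Multiset.map_singleton, Multiset.sum_singleton, ceilDiv]
    exact Nat.div_eq_of_lt_le (by omega) (by omega)
  have h2 : eRho m twoOnes.parts = 2 := by
    rw [twoOnes_parts, eRho, if_pos he]
    simp only [Multiset.map_cons, Multiset.map_singleton, Multiset.sum_cons, Multiset.sum_singleton,
      Multiset.insert_eq_cons, ceilDiv]
    have : (1 + (m - 2 - 1)) / (m - 2) = 1 := Nat.div_eq_of_lt_le (by omega) (by omega)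
    omega
  refine ⟨h1, h2, ?_⟩
  rw [eXi, Finset.sup_insert, Finset.sup_singleton, h1, h2]
  rfl

/-- **Ikenmeyer–Kandasamy 2020, Thm. 4.3, the sentence "Note that `ν = λ + (m × e_Ξ D)`"**
(TeX L418; chunk p0008.txt:L56): with `λ = (2m)`, `e_Ξ D = 2m`, the shifted partition
`addRect (2m) m (2m)` of Thm. 4.2 has the parts `(4m, 2m, …, 2m)` of the tree's `ikPartition m`
(`PowerSumProductObstructions.lean`), hence the same dual weight `ν^*`; so `IK2020_thm_4_2` at this
data speaks about exactly the weight of `IK2020_thm_4_3`. PROVED. [cite: IkenmeyerKandasamy2019, Thm. 4.3] -/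
theorem addRect_indiscrete_parts_eq_ikPartition (m : ℕ) (hm : 1 ≤ m)
    (h : (Nat.Partition.indiscrete (2 * m)).parts.card ≤ m) :
    (addRect (Nat.Partition.indiscrete (2 * m)) m (2 * m) h).parts = (ikPartition m).parts ∧
      Weight.dualOfPartition m (addRect (Nat.Partition.indiscrete (2 * m)) m (2 * m) h) =
        Weight.dualOfPartition m (ikPartition m) := by
  have hp : (addRect (Nat.Partition.indiscrete (2 * m)) m (2 * m) h).parts =
      (ikPartition m).parts := by
    have hi : (Nat.Partition.indiscrete (2 * m)).parts = {2 * m} :=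
      Nat.Partition.indiscrete_parts (by omega)
    simp only [addRect, ikPartition, Nat.Partition.ofSums, hi, Multiset.map_singleton,
      Multiset.card_singleton]
    congr 2
    ring
  refine ⟨hp, ?_⟩
  funext i
  simp only [Weight.dualOfPartition, Weight.dual, Weight.ofPartition_apply, Nat.Partition.sortedParts, hp]

end IK2020

end Literature.Computability.AlgebraicComplexity

end
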